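import Literature.MathematicalPhysics.QuantumLattice.HeisenbergOrderNeelProofs
import HarnessLib

/-!
# Kennedy–Lieb–Shastry / Dyson–Lieb–Simon: Gaussian domination ⇒ the `T = 0` infrared bound (A)

Trunk T-QLATTICE; sibling proof file of `HeisenbergOrder.lean` / `HeisenbergOrderNeelProofs.lean`
(named fact `kennedy_lieb_shastry_ground`, item
`provefact-Literature.MathematicalPhysics.QuantumLa-0a1fdca558`). No statement of the tree is
changed and no named fact is introduced. This file carries out, for the Heisenberg antiferromagnet
`H = Σ_{⟨xy⟩} 𝐒_x · 𝐒_y` on the even tori, the *direct ground-state derivation* of the infrared bound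
of Kennedy–Lieb–Shastry, J. Stat. Phys. 53 (1988) 1019–1030, pp. 1026–1027, eqs. (12)–(19), from
**ground-state Gaussian domination** (eq. (18)) taken as an explicit hypothesis — exactly as the
tree does for the XY model in `XYOrderInfraredProofs.lean`, whose abstract core
(`Matrix.groundState_infraredBound_quadratic`) and Fourier lemmas are reused:

* `heisStagGradField`, `heisFieldHamiltonian`: the field-dependent Hamiltonian
  `H(h) = H - Σ_{⟨xy⟩}(h_x - h_y)(S̃¹_x - S̃¹_y) + ½Σ_{⟨xy⟩}(h_x - h_y)²` with the *staggered* first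
  component `S̃¹_x = (-1)^x S¹_x` — the original-frame form of KLS eq. (17) (there written after the
  sublattice rotation (15)–(16), which turns `S̃¹` into `T¹`); Gaussian domination is the statement
  `E₀(H) ≤ E₀(H(h))` for all real `h` (KLS eq. (18));
* the staggered modes: for the field `cos(p·x)` one has `V = 2E_p C_{p+Q}` with the plain cosine
  mode `C_q = Σ_x cos(q·x) S¹_x` of the XY files (`(-1)^x cos(p·x) = cos((p+Q)·x)` on the even
  torus), so the bound lands at the shifted momentum `q = p + Q` with `E_p = E_{q-Q}` in the
  denominator (KLS eq. (14): `χ_q ≤ ¼ E_{q-Q}⁻¹`);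
* the double commutator (KLS eq. (13)) for the antiferromagnet: for a wave `A = Σ a_x S¹_x`,
  `[A, [𝐒_x·𝐒_y, A]] = -(a_x - a_y)² (S²_xS²_y + S³_xS³_y)`, whence with isotropy (I) and the axis
  symmetry (SYM) `Re ω([C_q,[H,C_q]]) + Re ω([D_q,[H,D_q]]) = -4 ε |Λ| E_q`;
* the assembly `heis_infraredBound_of_groundEnergy_le`: (GD) on the torus of side `2k ≥ 4`
  implies, for every `q ≠ Q`, `0 ≤ ĝ_q` and `ĝ_q² E_{q-Q} ≤ (-ε/2) E_q` — precisely the hypothesis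
  (A) of `kennedy_lieb_shastry_ground_of_infraredBound` (`HeisenbergOrderNeelAssembly.lean`), i.e.
  KLS eq. (1) with `e₀ = -3dε`.

## References

* [KLS1988JSP] T. Kennedy, E. H. Lieb, B. S. Shastry, J. Stat. Phys. 53 (1988) 1019–1030,
  eqs. (1), (12)–(19).
* [DysonLiebSimon1978] F. J. Dyson, E. H. Lieb, B. Simon, J. Stat. Phys. 18 (1978) 335–383, §3
  (Gaussian domination and the infrared bound at positive temperature).
-/

noncomputable section

open Matrix Finset Filter Topology
open scoped ComplexOrder
open Literature.MathematicalPhysics.QuantumLattice Literature.MathematicalPhysics.QuantumLattice.SpinOperators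
  Literature.Probability.LatticeModels

namespace Matrix

variable {m : Type*} [Fintype m] [DecidableEq m]

-- the commutator bracket of an associative ring, enabled locally (as in `XYOrderInfraredProofs`)
attribute [local instance 100] LieRing.ofAssociativeRing

/-- `Re ω(W (H - E₀) W) = ½ Re ω([W, [H, W]])` for the tracial ground state of a Hermitian `H`.
[Kennedy–Lieb–Shastry, J. Stat. Phys. 53 (1988), eqs. (12)–(13)] [cite: KLS1988JSP, eqs. (12)–(13)] -/
theorem re_groundStateFunctional_conj_eq_lie_lie {H : Matrix m m ℂ} (hH : H.IsHermitian)
    (W : Matrix m m ℂ) :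
    (H.groundStateFunctional (W * (H - (H.groundEnergy : ℂ) • 1) * W)).re =
      (H.groundStateFunctional ⁅W, ⁅H, W⁆⁆).re / 2 := by
  rw [Matrix.groundStateFunctional_mul_sub_groundEnergy_mul hH W,
    show (⁅W, ⁅H, W⁆⁆ : Matrix m m ℂ) = W * (H * W) - W * (W * H) - (H * W * W - W * (H * W)) by
      simp only [Ring.lie_def, mul_sub, sub_mul, mul_assoc]]
  simp only [Complex.mul_re, one_div, Complex.inv_re, Complex.inv_im]
  norm_num
  ring

end Matrix

namespace Literature.MathematicalPhysics.QuantumLattice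

variable {d : ℕ}

attribute [local instance 100] LieRing.ofAssociativeRing

/-! ### The staggered field Hamiltonian -/

/-- The Néel sign `(-1)^{Σᵢ xᵢ}` of a site of the torus, on canonical representatives (a consistent
sublattice sign for even side). [Dyson–Lieb–Simon 1978, §1] [folklore] -/
def neelSign {L : ℕ} (x : TorusSite d L) : ℝ := (-1 : ℝ) ^ (∑ i, (x i).val)

/-- The staggered first spin component `S̃¹_x = (-1)^x S¹_x` (the operator `T¹_x` of
Kennedy–Lieb–Shastry, J. Stat. Phys. 53 (1988), eq. (16), rotated back to the original frame).
[cite: KLS1988JSP, eqs. (15)–(16)] -/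
def stagSiteSpinX (L : ℕ) [NeZero L] (n : ℕ) (x : TorusSite d L) : Op (TorusSite d L) (n + 1) :=
  (neelSign x : ℂ) • siteSpin n x 0

/-- The staggered field term `V_h = Σ_x Σᵢ (h_x - h_{x+eᵢ}) (S̃¹_x - S̃¹_{x+eᵢ})` (the cross term of
the completed square of KLS eq. (17), in the original frame). [cite: KLS1988JSP, eq. (17)] -/
def heisStagGradField (L : ℕ) [NeZero L] (n : ℕ) (h : TorusSite d L → ℝ) :
    Op (TorusSite d L) (n + 1) :=
  ∑ x : TorusSite d L, ∑ i : Fin d,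
    ((h x - h (x + Pi.single i 1) : ℝ) : ℂ) • (stagSiteSpinX L n x - stagSiteSpinX L n (x + Pi.single i 1))

/-- The field-dependent Hamiltonian of the antiferromagnet,
`H(h) = H - Σ_{⟨xy⟩}(h_x - h_y)(S̃¹_x - S̃¹_y) + ½ Σ_{⟨xy⟩}(h_x - h_y)²`, `H = heisenbergTorus d L n 1`
(`H(0) = H`); the field energy is the model-independent `xyFieldEnergy`. This is KLS eq. (17) in
the original frame, with only the field-carrying component completed to a square.
[cite: KLS1988JSP, eq. (17)] -/
def heisFieldHamiltonian (L : ℕ) [NeZero L] (n : ℕ) (h : TorusSite d L → ℝ) :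
    Op (TorusSite d L) (n + 1) :=
  heisenbergTorus d L n 1 - heisStagGradField L n h + ((xyFieldEnergy L h / 2 : ℝ) : ℂ) • 1

section API

variable (L : ℕ) [NeZero L] (n : ℕ)

/-- `S̃¹_x` is Hermitian. [folklore] -/
theorem stagSiteSpinX_isHermitian (x : TorusSite d L) : (stagSiteSpinX L n x).IsHermitian := by
  rw [stagSiteSpinX, IsHermitian, conjTranspose_smul, Complex.star_def, Complex.conj_ofReal,
    (siteSpin_isHermitian n x 0).eq]

/-- `V_0 = 0`. [folklore] -/
@[simp] theorem heisStagGradField_zero : heisStagGradField L n (0 : TorusSite d L → ℝ) = 0 := by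
  simp [heisStagGradField]

/-- `H(0) = H`. [Kennedy–Lieb–Shastry, J. Stat. Phys. 53 (1988), after eq. (17)] [folklore] -/
@[simp] theorem heisFieldHamiltonian_zero :
    heisFieldHamiltonian L n (0 : TorusSite d L → ℝ) = heisenbergTorus d L n 1 := by
  simp [heisFieldHamiltonian]

/-- `V_{t h} = t V_h`. [folklore] -/
theorem heisStagGradField_smul (t : ℝ) (h : TorusSite d L → ℝ) :
    heisStagGradField L n (t • h) = (t : ℂ) • heisStagGradField L n h := by
  simp only [heisStagGradField, Pi.smul_apply, smul_eq_mul, smul_sum, smul_smul, ← mul_sub,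
    Complex.ofReal_mul]

/-- `V_h` is Hermitian. [folklore] -/
theorem heisStagGradField_isHermitian (h : TorusSite d L → ℝ) :
    (heisStagGradField L n h).IsHermitian := by
  unfold heisStagGradField
  refine (isSelfAdjoint_sum _ fun x _ => isSelfAdjoint_sum _ fun i _ => ?_).isHermitian
  refine Matrix.IsHermitian.isSelfAdjoint ?_
  rw [IsHermitian, conjTranspose_smul, Complex.star_def, Complex.conj_ofReal,
    ((stagSiteSpinX_isHermitian L n x).sub (stagSiteSpinX_isHermitian L n _)).eq]

/-- `H(t h) = H - t V_h + ½ t² Q(h)`. [folklore] -/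
theorem heisFieldHamiltonian_smul (t : ℝ) (h : TorusSite d L → ℝ) :
    heisFieldHamiltonian L n (t • h) =
      heisenbergTorus d L n 1 + (t : ℂ) • (-heisStagGradField L n h) +
        ((t ^ 2 * xyFieldEnergy L h / 2 : ℝ) : ℂ) • 1 := by
  rw [heisFieldHamiltonian, heisStagGradField_smul, xyFieldEnergy_smul, smul_neg, sub_eq_add_neg]

/-- Summation by parts on the torus: `V_h = Σ_x (Σᵢ (2h_x - h_{x+eᵢ} - h_{x-eᵢ})) S̃¹_x`.
[folklore] -/
theorem heisStagGradField_eq_sum_laplacian (h : TorusSite d L → ℝ) :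
    heisStagGradField L n h = ∑ x : TorusSite d L,
      ((∑ i : Fin d, (2 * h x - h (x + Pi.single i 1) - h (x - Pi.single i 1)) : ℝ) : ℂ) •
        stagSiteSpinX L n x := by
  have hL : heisStagGradField L n h =
      (∑ x : TorusSite d L, ∑ i : Fin d, ((h x - h (x + Pi.single i 1) : ℝ) : ℂ) •
          stagSiteSpinX L n x) -
        ∑ x : TorusSite d L, ∑ i : Fin d,
          ((h x - h (x + Pi.single i 1) : ℝ) : ℂ) • stagSiteSpinX L n (x + Pi.single i 1) := by
    unfold heisStagGradField
    rw [← sum_sub_distrib]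
    refine sum_congr rfl fun x _ => ?_
    rw [← sum_sub_distrib]
    exact sum_congr rfl fun i _ => smul_sub _ _ _
  have hre : ∀ i : Fin d, ∑ x : TorusSite d L,
      ((h x - h (x + Pi.single i 1) : ℝ) : ℂ) • stagSiteSpinX L n (x + Pi.single i 1) =
        ∑ x : TorusSite d L, ((h (x - Pi.single i 1) - h x : ℝ) : ℂ) • stagSiteSpinX L n x := by
    intro i
    rw [← (Equiv.subRight (Pi.single i (1 : ZMod L))).sum_comp]
    refine sum_congr rfl fun x _ => ?_
    simp only [Equiv.subRight_apply, sub_add_cancel]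
  have h2 : ∑ x : TorusSite d L, ∑ i : Fin d,
      ((h x - h (x + Pi.single i 1) : ℝ) : ℂ) • stagSiteSpinX L n (x + Pi.single i 1) =
        ∑ x : TorusSite d L, ∑ i : Fin d,
          ((h (x - Pi.single i 1) - h x : ℝ) : ℂ) • stagSiteSpinX L n x := by
    rw [sum_comm, sum_congr rfl fun i _ => hre i, sum_comm]
  rw [hL, h2, ← sum_sub_distrib]
  refine sum_congr rfl fun x _ => ?_
  rw [← sum_sub_distrib, Complex.ofReal_sum, sum_smul]
  refine sum_congr rfl fun i _ => ?_
  rw [← sub_smul, ← Complex.ofReal_sub]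
  congr 1
  push_cast
  ring

end API

/-! ### The Néel sign and the shift `q = p + Q` of the Fourier modes -/

section Shift

variable (k : ℕ) [NeZero (2 * k)]

/-- `Q·z = (Σᵢ zᵢ) π` on canonical representatives. [folklore] -/
theorem torusPhase_neelIndex (z : TorusSite d (2 * k)) :
    torusPhase (2 * k) (neelIndex (2 * k)) z = ((∑ i, (z i).val : ℕ) : ℝ) * Real.pi := by
  have hk := one_le_of_neZero_two_mul k
  have hk0 : (k : ℝ) ≠ 0 := by exact_mod_cast (show k ≠ 0 by omega)
  unfold torusPhase
  simp only [neelIndex_val k]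
  rw [← mul_sum]
  push_cast
  field_simp

/-- The character of the Néel point is the Néel sign: `χ_Q(z) = (-1)^{Σᵢ zᵢ}`. [folklore] -/
theorem torusChar_neelIndex (z : TorusSite d (2 * k)) :
    (∏ j, (ZMod.stdAddChar ((neelIndex (2 * k) : TorusSite d (2 * k)) j * z j) : ℂ)) =
      (neelSign z : ℂ) := by
  rw [torusChar_eq_exp, torusPhase_neelIndex k, neelSign, Complex.ofReal_mul,
    Complex.ofReal_natCast, mul_assoc, Complex.exp_nat_mul, Complex.exp_pi_mul_I,
    Complex.ofReal_pow, Complex.ofReal_neg, Complex.ofReal_one]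

/-- `χ_{p+Q}(z) = (-1)^z χ_p(z)`. [folklore] -/
theorem torusChar_add_neelIndex (p z : TorusSite d (2 * k)) :
    (∏ j, (ZMod.stdAddChar ((p + neelIndex (2 * k) : TorusSite d (2 * k)) j * z j) : ℂ)) =
      (neelSign z : ℂ) * ∏ j, (ZMod.stdAddChar (p j * z j) : ℂ) := by
  rw [← torusChar_neelIndex k z, ← prod_mul_distrib]
  refine prod_congr rfl fun j _ => ?_
  rw [Pi.add_apply, add_mul, AddChar.map_add_eq_mul, mul_comm]

/-- `(-1)^z cos(p·z) = cos((p+Q)·z)` on the even torus. [Dyson–Lieb–Simon 1978, §1 (the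
substitution `p ↦ p + (π,…,π)`)] [folklore] -/
theorem neelSign_mul_cos_torusPhase (p z : TorusSite d (2 * k)) :
    neelSign z * Real.cos (torusPhase (2 * k) p z) =
      Real.cos (torusPhase (2 * k) (p + neelIndex (2 * k)) z) := by
  rw [← torusChar_re, ← torusChar_re, torusChar_add_neelIndex k, Complex.re_ofReal_mul]

/-- `(-1)^z sin(p·z) = sin((p+Q)·z)` on the even torus. [folklore] -/
theorem neelSign_mul_sin_torusPhase (p z : TorusSite d (2 * k)) :
    neelSign z * Real.sin (torusPhase (2 * k) p z) =
      Real.sin (torusPhase (2 * k) (p + neelIndex (2 * k)) z) := by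
  rw [← torusChar_im, ← torusChar_im, torusChar_add_neelIndex k, Complex.im_ofReal_mul]

/-- **The staggered field of a cosine wave is the shifted cosine mode**:
`V_{cos(p·)} = 2E_p C_{p+Q}`. [Kennedy–Lieb–Shastry, J. Stat. Phys. 53 (1988), after eq. (19)
("changes `S_q` to `S_{q-Q}`")] [cite: KLS1988JSP, after eq. (19)] -/
theorem heisStagGradField_cos (n : ℕ) (p : TorusSite d (2 * k)) :
    heisStagGradField (2 * k) n (fun x => Real.cos (torusPhase (2 * k) p x)) =
      ((2 * dispersion (latticeMomentum (2 * k) p) : ℝ) : ℂ) •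
        xyCosMode (2 * k) n (p + neelIndex (2 * k)) := by
  rw [heisStagGradField_eq_sum_laplacian, xyCosMode, smul_sum]
  refine sum_congr rfl fun x _ => ?_
  rw [laplacian_cos_torusPhase, stagSiteSpinX, smul_smul, smul_smul, ← Complex.ofReal_mul,
    ← Complex.ofReal_mul, ← neelSign_mul_cos_torusPhase k]
  congr 1
  push_cast
  ring

/-- `V_{sin(p·)} = 2E_p D_{p+Q}`. [folklore] -/
theorem heisStagGradField_sin (n : ℕ) (p : TorusSite d (2 * k)) :
    heisStagGradField (2 * k) n (fun x => Real.sin (torusPhase (2 * k) p x)) =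
      ((2 * dispersion (latticeMomentum (2 * k) p) : ℝ) : ℂ) •
        xySinMode (2 * k) n (p + neelIndex (2 * k)) := by
  rw [heisStagGradField_eq_sum_laplacian, xySinMode, smul_sum]
  refine sum_congr rfl fun x _ => ?_
  rw [laplacian_sin_torusPhase, stagSiteSpinX, smul_smul, smul_smul, ← Complex.ofReal_mul,
    ← Complex.ofReal_mul, ← neelSign_mul_sin_torusPhase k]
  congr 1
  push_cast
  ring

end Shift

/-! ### The structure factor through the two modes -/

section StructureFactor

variable (L : ℕ) [NeZero L] (n : ℕ)

/-- `ω(A_a A_b) = Σ_{x,y} a_x b_y ω(S¹_x S¹_y)` for real coefficient families and any finite-volume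
functional `ω = ω_A`. [folklore] -/
theorem groundStateFunctional_realWave_mul (A : Op (TorusSite d L) (n + 1))
    (a b : TorusSite d L → ℝ) :
    A.groundStateFunctional
        ((∑ x : TorusSite d L, (a x : ℂ) • siteSpin n x 0) *
          ∑ y : TorusSite d L, (b y : ℂ) • siteSpin n y 0) =
      ∑ x : TorusSite d L, ∑ y : TorusSite d L, ((a x * b y : ℝ) : ℂ) *
        A.groundStateFunctional (siteSpin n x 0 * siteSpin n y 0) := by
  rw [sum_mul_sum, map_sum]
  refine sum_congr rfl fun x _ => ?_
  rw [map_sum]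
  refine sum_congr rfl fun y _ => ?_
  rw [smul_mul_assoc, mul_smul_comm, smul_smul, LinearMap.map_smul, smul_eq_mul,
    Complex.ofReal_mul]

/-- **The structure factor through the modes**: `L^d ĝ¹_q = Re ω(C_q²) + Re ω(D_q²)` for the
antiferromagnet. [Kennedy–Lieb–Shastry 1988, p. 1021, def. of `g_q`] [folklore] -/
theorem heisStructureFactor_eq_modes (q : TorusSite d L) :
    heisStructureFactor 0 L n q * (L : ℝ) ^ d =
      ((heisenbergTorus d L n 1).groundStateFunctional (xyCosMode L n q * xyCosMode L n q)).re +
        ((heisenbergTorus d L n 1).groundStateFunctional (xySinMode L n q * xySinMode L n q)).re := by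
  have hL : (0 : ℝ) < (L : ℝ) ^ d := by
    have : (0 : ℝ) < L := by exact_mod_cast Nat.pos_of_ne_zero (NeZero.ne L)
    positivity
  rw [heisStructureFactor_of_neZero, div_mul_cancel₀ _ hL.ne', xyCosMode, xySinMode,
    groundStateFunctional_realWave_mul, groundStateFunctional_realWave_mul, Complex.re_sum,
    Complex.re_sum, ← sum_add_distrib]
  refine sum_congr rfl fun x _ => ?_
  rw [Complex.re_sum, Complex.re_sum, ← sum_add_distrib]
  refine sum_congr rfl fun y _ => ?_
  rw [Complex.re_ofReal_mul, Complex.re_ofReal_mul, heisGroundCorr_of_neZero, cos_torusPhase_sub]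
  ring

end StructureFactor

/-! ### The double commutator of the antiferromagnet with a wave of the first component -/

section SiteAlgebra

variable {Λ : Type*} [Fintype Λ] [DecidableEq Λ] {n : ℕ}

/-- **The `3–3` bond double commutator.** For `x ≠ y` and `A = Σ_u a_u S¹_u`:
`[A, [S³_xS³_y, A]] = -(a_x² + a_y²) S³_xS³_y + 2a_xa_y S²_xS²_y`.
[Kennedy–Lieb–Shastry, J. Stat. Phys. 53 (1988), eq. (13) ("after some computation")] [folklore] -/
theorem lie_lie_zbond (a : Λ → ℂ) {x y : Λ} (hxy : x ≠ y) :
    ⁅(∑ u : Λ, a u • (siteSpin n u 0 : Op Λ (n + 1))),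
      ⁅siteSpin n x 2 * siteSpin n y 2, ∑ u : Λ, a u • (siteSpin n u 0 : Op Λ (n + 1))⁆⁆ =
      -(a x ^ 2 + a y ^ 2) • (siteSpin n x 2 * siteSpin n y 2) +
        (2 * a x * a y) • (siteSpin n x 1 * siteSpin n y 1) := by
  set X0 : Op Λ (n + 1) := siteSpin n x 0
  set X1 : Op Λ (n + 1) := siteSpin n x 1
  set X2 : Op Λ (n + 1) := siteSpin n x 2
  set Y0 : Op Λ (n + 1) := siteSpin n y 0
  set Y1 : Op Λ (n + 1) := siteSpin n y 1
  set Y2 : Op Λ (n + 1) := siteSpin n y 2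
  set B : Op Λ (n + 1) := X2 * Y2 with hB
  have hc : ∀ {u v : Λ} (huv : u ≠ v) (α β : Fin 3),
      Commute (siteSpin n u α : Op Λ (n + 1)) (siteSpin n v β) :=
    fun huv α β => siteSpin_commute_of_ne_holds n huv α β
  have hB0 : ∀ v, v ≠ x ∧ v ≠ y → ⁅B, (siteSpin n v 0 : Op Λ (n + 1))⁆ = 0 := by
    rintro v ⟨hvx, hvy⟩
    refine Commute.lie_eq ?_
    exact (hc hvx.symm 2 0).mul_left (hc hvy.symm 2 0)
  -- `[B, S¹_x] = i S²_x S³_y`, `[B, S¹_y] = i S³_x S²_y`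
  have hBx : ⁅B, X0⁆ = Complex.I • (X1 * Y2) := by
    rw [hB, ← lie_skew, lie_mul_of_commute_right X2 (hc hxy 0 2), lie_siteSpin_zero_two,
      smul_mul_assoc, neg_smul, neg_neg]
  have hBy : ⁅B, Y0⁆ = Complex.I • (X2 * Y1) := by
    rw [hB, ← lie_skew, lie_mul_of_commute_left Y2 (hc hxy.symm 0 2), lie_siteSpin_zero_two,
      mul_smul_comm, neg_smul, neg_neg]
  have hBA : ⁅B, ∑ u : Λ, a u • (siteSpin n u 0 : Op Λ (n + 1))⁆ =
      (Complex.I * a x) • (X1 * Y2) + (Complex.I * a y) • (X2 * Y1) := by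
    rw [lie_sum, Fintype.sum_eq_add x y hxy (fun v hv => by rw [lie_smul, hB0 v hv, smul_zero]),
      lie_smul, lie_smul, hBx, hBy, smul_smul, smul_smul, mul_comm (a x), mul_comm (a y)]
  have hx1 : ⁅X0, X2 * Y1⁆ = -Complex.I • (X1 * Y1) := by
    rw [lie_mul_of_commute_right X2 (hc hxy 0 1), lie_siteSpin_zero_two, smul_mul_assoc]
  have hx2 : ⁅X0, X1 * Y2⁆ = Complex.I • (X2 * Y2) := by
    rw [lie_mul_of_commute_right X1 (hc hxy 0 2), lie_siteSpin_zero_one, smul_mul_assoc]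
  have hy1 : ⁅Y0, X2 * Y1⁆ = Complex.I • (X2 * Y2) := by
    rw [lie_mul_of_commute_left Y1 (hc hxy.symm 0 2), lie_siteSpin_zero_one, mul_smul_comm]
  have hy2 : ⁅Y0, X1 * Y2⁆ = -Complex.I • (X1 * Y1) := by
    rw [lie_mul_of_commute_left Y2 (hc hxy.symm 0 1), lie_siteSpin_zero_two, mul_smul_comm]
  have hu0 : ∀ u, u ≠ x ∧ u ≠ y →
      ⁅(siteSpin n u 0 : Op Λ (n + 1)),
        (Complex.I * a x) • (X1 * Y2) + (Complex.I * a y) • (X2 * Y1)⁆ = 0 := by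
    rintro u ⟨hux, huy⟩
    refine Commute.lie_eq ?_
    exact (((hc hux 0 1).mul_right (hc huy 0 2)).smul_right _).add_right
      (((hc hux 0 2).mul_right (hc huy 0 1)).smul_right _)
  have hII : Complex.I * Complex.I = -1 := Complex.I_mul_I
  have hII' : Complex.I * (-Complex.I) = 1 := by rw [mul_neg, Complex.I_mul_I, neg_neg]
  rw [hBA, sum_lie, Fintype.sum_eq_add x y hxy (fun u hu => by rw [smul_lie, hu0 u hu, smul_zero]),
    smul_lie, smul_lie, lie_add, lie_add, lie_smul, lie_smul, lie_smul, lie_smul, hx1, hx2, hy1,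
    hy2]
  simp only [smul_smul, smul_add, ← mul_assoc]
  have e1 : a x * Complex.I * a x * Complex.I = -(a x ^ 2) := by
    linear_combination (a x ^ 2) * hII
  have e2 : a x * Complex.I * a y * -Complex.I = a x * a y := by
    linear_combination (a x * a y) * hII'
  have e3 : a y * Complex.I * a x * -Complex.I = a x * a y := by
    linear_combination (a x * a y) * hII'
  have e4 : a y * Complex.I * a y * Complex.I = -(a y ^ 2) := by
    linear_combination (a y ^ 2) * hII
  rw [e1, e2, e3, e4]
  module

/-- **The exchange double commutator.** For `x ≠ y` and `A = Σ_u a_u S¹_u`: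
`[A, [S¹_xS¹_y + S²_xS²_y + S³_xS³_y, A]] = -(a_x - a_y)² (S²_xS²_y + S³_xS³_y)`.
[Kennedy–Lieb–Shastry, J. Stat. Phys. 53 (1988), eq. (13)] [cite: KLS1988JSP, eq. (13)] -/
theorem lie_lie_exchange (a : Λ → ℂ) {x y : Λ} (hxy : x ≠ y) :
    ⁅(∑ u : Λ, a u • (siteSpin n u 0 : Op Λ (n + 1))),
      ⁅siteSpin n x 0 * siteSpin n y 0 + siteSpin n x 1 * siteSpin n y 1 +
          siteSpin n x 2 * siteSpin n y 2,
        ∑ u : Λ, a u • (siteSpin n u 0 : Op Λ (n + 1))⁆⁆ =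
      -((a x - a y) ^ 2) • (siteSpin n x 1 * siteSpin n y 1 + siteSpin n x 2 * siteSpin n y 2) := by
  rw [add_lie, lie_add, lie_lie_bond a hxy, lie_lie_zbond a hxy]
  module

end SiteAlgebra

section HamiltonianDC

variable (L : ℕ) [NeZero L] (n : ℕ)

/-- The `J = 1` antiferromagnet as an edge sum. [folklore] -/
theorem heisenbergTorus_one_eq_sum :
    heisenbergTorus d L n 1 = ∑ e ∈ (torusGraph d L).edgeFinset, spinDotSym n e := by
  rw [show heisenbergTorus d L n 1 = ((1 : ℝ) : ℂ) • ∑ e ∈ (torusGraph d L).edgeFinset,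
    spinDotSym n e from rfl, Complex.ofReal_one, one_smul]

/-- **The double commutator of the antiferromagnet with a wave of the first component**:
`[A, [H, A]] = -Σ_{⟨xy⟩} (a_x - a_y)² (spinBond 1 + spinBond 2)(x,y)`.
[Kennedy–Lieb–Shastry, J. Stat. Phys. 53 (1988), eq. (13)] [cite: KLS1988JSP, eq. (13)] -/
theorem lie_lie_heisenbergTorus (a : TorusSite d L → ℂ) :
    ⁅(∑ u : TorusSite d L, a u • (siteSpin n u 0 : Op (TorusSite d L) (n + 1))),
      ⁅heisenbergTorus d L n 1,
        ∑ u : TorusSite d L, a u • (siteSpin n u 0 : Op (TorusSite d L) (n + 1))⁆⁆ =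
      ∑ e ∈ (torusGraph d L).edgeFinset,
        Sym2.lift ⟨fun x y => -((a x - a y) ^ 2) • (spinBond n 1 x y + spinBond n 2 x y),
          fun x y => by
            dsimp only
            rw [spinBond_comm n 1 x y, spinBond_comm n 2 x y, ← neg_sub (a x) (a y), neg_sq]⟩ e := by
  rw [heisenbergTorus_one_eq_sum, sum_lie (torusGraph d L).edgeFinset,
    lie_sum (torusGraph d L).edgeFinset]
  refine sum_congr rfl fun e he => ?_
  revert he
  refine Sym2.ind (fun x y => ?_) e
  intro he
  have hxy : x ≠ y := ne_of_mk_mem_edgeFinset he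
  simp only [Sym2.lift_mk, spinDotSym_mk]
  have hT : (spinDot n x y : Op (TorusSite d L) (n + 1)) =
      siteSpin n x 0 * siteSpin n y 0 + siteSpin n x 1 * siteSpin n y 1 +
        siteSpin n x 2 * siteSpin n y 2 := by
    rw [spinDot, Fin.sum_univ_three, spinBond_eq_mul_of_ne hxy 0, spinBond_eq_mul_of_ne hxy 1,
      spinBond_eq_mul_of_ne hxy 2]
  rw [hT, lie_lie_exchange a hxy, spinBond_eq_mul_of_ne hxy 1, spinBond_eq_mul_of_ne hxy 2]

/-- The ground-state expectation of the double commutator, edge by edge (with isotropy (I)):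
`Re ω([A, [H, A]]) = -2 Σ_{⟨xy⟩} (a_x - a_y)² G¹(x,y)` for a real wave `a`.
[Kennedy–Lieb–Shastry, J. Stat. Phys. 53 (1988), eq. (13)] [folklore] -/
theorem re_groundStateFunctional_heis_lie_lie (a : TorusSite d L → ℝ) :
    ((heisenbergTorus d L n 1).groundStateFunctional
      ⁅(∑ u : TorusSite d L, (a u : ℂ) • (siteSpin n u 0 : Op (TorusSite d L) (n + 1))),
        ⁅heisenbergTorus d L n 1,
          ∑ u : TorusSite d L, (a u : ℂ) • (siteSpin n u 0 : Op (TorusSite d L) (n + 1))⁆⁆).re =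
      ∑ e ∈ (torusGraph d L).edgeFinset,
        Sym2.lift ⟨fun x y => -2 * (a x - a y) ^ 2 * heisGroundCorr 0 L n x y, fun x y => by
            dsimp only
            rw [heisGroundCorr_symm 0 L n x y, ← neg_sub (a x) (a y), neg_sq]⟩ e := by
  rw [lie_lie_heisenbergTorus, map_sum, Complex.re_sum]
  refine sum_congr rfl fun e _ => ?_
  refine Sym2.ind (fun x y => ?_) e
  simp only [Sym2.lift_mk, LinearMap.map_smul, smul_eq_mul, map_add]
  rw [show (-(((a x : ℂ) - (a y : ℂ)) ^ 2)) = ((-((a x - a y) ^ 2) : ℝ) : ℂ) by push_cast; ring,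
    Complex.re_ofReal_mul, Complex.add_re, re_groundStateFunctional_heis_spinBond,
    re_groundStateFunctional_heis_spinBond, heisGroundCorr_one_eq_zero, heisGroundCorr_two_eq_zero]
  ring

/-- **The two modes together**: for side `L ≥ 3`,
`Re ω([C_q,[H,C_q]]) + Re ω([D_q,[H,D_q]]) = -4 Σᵢ (1 - cos qᵢ) Σ_z G¹(z, z+eᵢ)`.
[Kennedy–Lieb–Shastry, J. Stat. Phys. 53 (1988), eq. (13): `½⟨[[S_q,H],S_{-q}]⟩ = 2e₀E_q/3d`]
[folklore] -/
theorem re_groundStateFunctional_heis_lie_lie_modes (hL : 3 ≤ L) (q : TorusSite d L) :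
    ((heisenbergTorus d L n 1).groundStateFunctional
        ⁅xyCosMode L n q, ⁅heisenbergTorus d L n 1, xyCosMode L n q⁆⁆).re +
      ((heisenbergTorus d L n 1).groundStateFunctional
        ⁅xySinMode L n q, ⁅heisenbergTorus d L n 1, xySinMode L n q⁆⁆).re =
      -4 * ∑ i : Fin d, (1 - Real.cos (latticeMomentum L q i)) *
        ∑ z : TorusSite d L, heisGroundCorr 0 L n z (z + Pi.single i 1) := by
  rw [xyCosMode, xySinMode, re_groundStateFunctional_heis_lie_lie,
    re_groundStateFunctional_heis_lie_lie, ← sum_add_distrib]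
  have hcomb : ∀ e ∈ (torusGraph d L).edgeFinset,
      Sym2.lift ⟨fun x y => -2 * (Real.cos (torusPhase L q x) - Real.cos (torusPhase L q y)) ^ 2 *
          heisGroundCorr 0 L n x y, fun x y => by
            dsimp only
            rw [heisGroundCorr_symm 0 L n x y, ← neg_sub (Real.cos _) (Real.cos _), neg_sq]⟩ e +
        Sym2.lift ⟨fun x y => -2 * (Real.sin (torusPhase L q x) - Real.sin (torusPhase L q y)) ^ 2 *
          heisGroundCorr 0 L n x y, fun x y => by
            dsimp only
            rw [heisGroundCorr_symm 0 L n x y, ← neg_sub (Real.sin _) (Real.sin _), neg_sq]⟩ e =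
      -4 * Sym2.lift ⟨fun x y => (1 - Real.cos (torusPhase L q (x - y))) * heisGroundCorr 0 L n x y,
          fun x y => by
            dsimp only
            rw [heisGroundCorr_symm 0 L n x y, cos_torusPhase_sub, cos_torusPhase_sub]; ring⟩ e := by
    intro e _
    refine Sym2.ind (fun x y => ?_) e
    simp only [Sym2.lift_mk]
    rw [cos_torusPhase_sub]
    linear_combination (-2 * heisGroundCorr 0 L n x y) * Real.cos_sq_add_sin_sq (torusPhase L q x) +
      (-2 * heisGroundCorr 0 L n x y) * Real.cos_sq_add_sin_sq (torusPhase L q y)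
  rw [sum_congr rfl hcomb, ← mul_sum]
  congr 1
  have hpairs := sum_pairs_eq_sum_edgeFinset (d := d) L (by omega)
    (Sym2.lift ⟨fun x y => (1 - Real.cos (torusPhase L q (x - y))) * heisGroundCorr 0 L n x y,
      fun x y => by
        dsimp only
        rw [heisGroundCorr_symm 0 L n x y, cos_torusPhase_sub, cos_torusPhase_sub]; ring⟩)
  rw [if_neg (by omega), one_mul] at hpairs
  rw [← hpairs, sum_comm]
  refine sum_congr rfl fun i _ => ?_
  rw [mul_sum]
  refine sum_congr rfl fun z _ => ?_
  simp only [Sym2.lift_mk]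
  rw [sub_add_cancel_left, cos_torusPhase_neg_single]

end HamiltonianDC

/-! ### (SYM) Axis permutations -/

section CoordinatePermutation

variable (L : ℕ) [NeZero L] (n : ℕ)

/-- The antiferromagnet on the torus is invariant under permutations of the coordinate axes
(relabelling of sites `x ↦ x ∘ s`, acting on tensor indices by `σ ↦ σ ∘ π`; the edge sum is
reindexed along the graph automorphism `Sym2.map π`). [folklore] -/
theorem heisenbergTorus_submatrix_comp_perm (s : Equiv.Perm (Fin d)) :
    (heisenbergTorus d L n 1).submatrix
        (fun σ : TensorIndex (TorusSite d L) (n + 1) =>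
          σ ∘ (Equiv.arrowCongr s.symm (Equiv.refl (ZMod L))))
        (fun σ => σ ∘ (Equiv.arrowCongr s.symm (Equiv.refl (ZMod L)))) =
      heisenbergTorus d L n 1 := by
  set π : TorusSite d L ≃ TorusSite d L := Equiv.arrowCongr s.symm (Equiv.refl (ZMod L)) with hπ
  rw [heisenbergTorus_one_eq_sum, submatrix_finset_sum]
  refine Finset.sum_nbij' (Sym2.map π) (Sym2.map π.symm) (fun e he => ?_) (fun e he => ?_)
    (fun e _ => ?_) (fun e _ => ?_) (fun e _ => ?_)
  · exact (map_comp_perm_mem_edgeFinset L s e).2 he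
  · exact (map_comp_perm_mem_edgeFinset L s.symm e).2 he
  · simp only [Sym2.map_map, Equiv.symm_comp_self, Sym2.map_id', id_eq]
  · simp only [Sym2.map_map, Equiv.self_comp_symm, Sym2.map_id', id_eq]
  · induction e using Sym2.ind with
    | h x y =>
      simp only [Sym2.map_mk, spinDotSym_mk, spinDot, submatrix_finset_sum, spinBond_submatrix_comp]

/-- `Gᵅ(x ∘ s, y ∘ s) = Gᵅ(x, y)` for a permutation `s` of the axes. [folklore] -/
theorem heisGroundCorr_comp_perm (s : Equiv.Perm (Fin d)) (α : Fin 3) (x y : TorusSite d L) :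
    heisGroundCorr α L n (x ∘ s) (y ∘ s) = heisGroundCorr α L n x y := by
  rw [heisGroundCorr_of_neZero, heisGroundCorr_of_neZero, ← arrowCongr_symm_apply L s x,
    ← arrowCongr_symm_apply L s y, ← siteSpin_submatrix_comp n _ x α,
    ← siteSpin_submatrix_comp n _ y α,
    ← Matrix.submatrix_mul _ _ _ _ _ (bijective_comp_equiv (q := n + 1) _),
    groundStateFunctional_submatrix_comp (heisenbergTorus_isHermitian d L n 1) _
      (heisenbergTorus_submatrix_comp_perm L n s)]

/-- **(SYM)** `Σ_z Gᵅ(z, z + eᵢ) = Σ_z Gᵅ(z, z + eⱼ)` (the transposition of the axes `i, j` is a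
symmetry of the torus and of `H`). [Kennedy–Lieb–Shastry 1988, eq. (3) ("`i = 1, 2, 3`")]
[folklore] -/
theorem sum_heisGroundCorr_dir_eq (α : Fin 3) (i j : Fin d) :
    ∑ z : TorusSite d L, heisGroundCorr α L n z (z + Pi.single i 1) =
      ∑ z : TorusSite d L, heisGroundCorr α L n z (z + Pi.single j 1) := by
  have hsi : (Equiv.swap i j).symm i = j := by rw [Equiv.symm_swap, Equiv.swap_apply_left]
  calc ∑ z : TorusSite d L, heisGroundCorr α L n z (z + Pi.single i 1)
      = ∑ z : TorusSite d L, heisGroundCorr α L n (z ∘ Equiv.swap i j)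
          ((z ∘ Equiv.swap i j : TorusSite d L) + Pi.single j 1) :=
        sum_congr rfl fun z _ => by
          rw [← heisGroundCorr_comp_perm L n (Equiv.swap i j) α z, add_single_comp_perm, hsi]
    _ = ∑ z : TorusSite d L, heisGroundCorr α L n z (z + Pi.single j 1) :=
        (Equiv.arrowCongr (Equiv.swap i j).symm (Equiv.refl (ZMod L))).sum_comp
          (fun z => heisGroundCorr α L n z (z + Pi.single j 1))

/-- (SYM) for the bond average: `Σ_z Gᵅ(z, z+eᵢ) = L^d εᵅ` for every direction `i`. [folklore] -/
theorem sum_heisGroundCorr_dir_eq_bondCorr (hd : 0 < d) (α : Fin 3) (i : Fin d) :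
    ∑ z : TorusSite d L, heisGroundCorr α L n z (z + Pi.single i 1) =
      heisBondCorr (d := d) α L n * (L : ℝ) ^ d := by
  have hL : (0 : ℝ) < (L : ℝ) ^ d := by
    have : (0 : ℝ) < L := by exact_mod_cast Nat.pos_of_ne_zero (NeZero.ne L)
    positivity
  have hd' : (0 : ℝ) < d := by exact_mod_cast hd
  rw [heisBondCorr_of_neZero, sum_comm,
    sum_congr rfl fun j _ => sum_heisGroundCorr_dir_eq L n α j i, sum_const, card_univ,
    Fintype.card_fin, nsmul_eq_mul]
  field_simp

end CoordinatePermutation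

/-! ### Assembly: Gaussian domination ⇒ the infrared bound (A) -/

section InfraredAssembly

/-- **One mode.** If `E₀(H) ≤ E₀(H(h))` for all fields and `V_h = r W` with `r ≠ 0`, `W` Hermitian,
then `0 ≤ ½ r⁻² Q(h) + 2μ Re ω(W²) + μ² Re ω(W (H - E₀) W)` for all real `μ`.
[Kennedy–Lieb–Shastry, J. Stat. Phys. 53 (1988), eqs. (18)–(19)] [cite: KLS1988JSP, eqs. (18)–(19)] -/
theorem heis_modeQuadratic_nonneg (L : ℕ) [NeZero L] (n : ℕ)
    (hGD : ∀ h : TorusSite d L → ℝ,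
      (heisenbergTorus d L n 1).groundEnergy ≤ (heisFieldHamiltonian L n h).groundEnergy)
    {h : TorusSite d L → ℝ} {W : Op (TorusSite d L) (n + 1)} (hW : W.IsHermitian) {r : ℝ}
    (hVh : heisStagGradField L n h = (r : ℂ) • W) (hr : r ≠ 0) (μ : ℝ) :
    0 ≤ r⁻¹ ^ 2 * xyFieldEnergy L h / 2 +
      2 * μ * ((heisenbergTorus d L n 1).groundStateFunctional (W * W)).re +
      μ ^ 2 * ((heisenbergTorus d L n 1).groundStateFunctional
        (W * (heisenbergTorus d L n 1 - ((heisenbergTorus d L n 1).groundEnergy : ℂ) • 1) * W)).re := by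
  have hV : heisStagGradField L n (r⁻¹ • h) = W := by
    rw [heisStagGradField_smul, hVh, smul_smul, ← Complex.ofReal_mul, inv_mul_cancel₀ hr,
      Complex.ofReal_one, one_smul]
  have hQ : xyFieldEnergy L (r⁻¹ • h) = r⁻¹ ^ 2 * xyFieldEnergy L h := xyFieldEnergy_smul L r⁻¹ h
  have key := Matrix.groundState_infraredBound_quadratic (heisenbergTorus_isHermitian d L n 1)
    hW.neg (Q := r⁻¹ ^ 2 * xyFieldEnergy L h) (fun t => by
      have ht := hGD (t • (r⁻¹ • h))
      rwa [heisFieldHamiltonian_smul, hV, hQ] at ht) μ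
  simpa only [neg_mul, mul_neg, neg_neg] using key

/-- **(GD) ⇒ (A) in finite volume, for the antiferromagnet.** On the even torus of side
`L = 2k ≥ 4`, `d ≥ 1`, every spin: if `E₀(H) ≤ E₀(H(h))` for all real staggered fields `h`
(KLS eq. (18)), then for every momentum `q ≠ Q`, `0 ≤ ĝ_q` and `ĝ_q² E_{q-Q} ≤ (-ε/2) E_q`
(KLS eq. (1) with `e₀ = -3dε`, i.e. `f_q² = e₀E_q/(6dE_{q-Q})`). The fields
`cos(p·)/2E_p`, `sin(p·)/2E_p`, `p = q - Q ≠ 0`, give `V = C_q`, `D_q` (staggering shifts the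
momentum by `Q`) and two quadratic inequalities whose sum has nonpositive discriminant:
`(L^d ĝ_q)² ≤ (L^d/4E_p) · ½(DC)` with `DC = -4 ε L^d E_q` (double commutator, (I), (SYM)).
[Kennedy–Lieb–Shastry, J. Stat. Phys. 53 (1988), eqs. (1), (12)–(14), (18)–(19)]
[cite: KLS1988JSP, eqs. (1), (12)–(19)] -/
theorem heis_infraredBound_of_groundEnergy_le (hd : 0 < d) (n k : ℕ) (hk : 2 ≤ k)
    (hGD : haveI : NeZero (2 * k) := ⟨by omega⟩
      ∀ h : TorusSite d (2 * k) → ℝ,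
        (heisenbergTorus d (2 * k) n 1).groundEnergy ≤
          (heisFieldHamiltonian (2 * k) n h).groundEnergy)
    (q : TorusSite d (2 * k)) (hq : q ≠ neelIndex (2 * k)) :
    0 ≤ heisStructureFactor 0 (2 * k) n q ∧
      heisStructureFactor 0 (2 * k) n q ^ 2 *
          dispersion (latticeMomentum (2 * k) (q - neelIndex (2 * k))) ≤
        (-heisBondCorr (d := d) 0 (2 * k) n / 2) * dispersion (latticeMomentum (2 * k) q) := by
  haveI : NeZero (2 * k) := ⟨by omega⟩
  have hL3 : 3 ≤ 2 * k := by omega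
  set H : Op (TorusSite d (2 * k)) (n + 1) := heisenbergTorus d (2 * k) n 1 with hH_def
  have hH : H.IsHermitian := heisenbergTorus_isHermitian d (2 * k) n 1
  set Q : TorusSite d (2 * k) := neelIndex (2 * k) with hQ_def
  set p : TorusSite d (2 * k) := q - Q with hp_def
  have hp : p ≠ 0 := sub_ne_zero.2 hq
  have hpQ : p + Q = q := sub_add_cancel q Q
  set E : ℝ := dispersion (latticeMomentum (2 * k) p) with hE_def
  have hE : 0 < E := dispersion_latticeMomentum_pos hp
  set Eq : ℝ := dispersion (latticeMomentum (2 * k) q) with hEq_def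
  set C : Op (TorusSite d (2 * k)) (n + 1) := xyCosMode (2 * k) n q with hC_def
  set D : Op (TorusSite d (2 * k)) (n + 1) := xySinMode (2 * k) n q with hD_def
  set K : Op (TorusSite d (2 * k)) (n + 1) := H - (H.groundEnergy : ℂ) • 1 with hK_def
  set aC : ℝ := (H.groundStateFunctional (C * C)).re with haC_def
  set aD : ℝ := (H.groundStateFunctional (D * D)).re with haD_def
  set bC : ℝ := (H.groundStateFunctional (C * K * C)).re with hbC_def
  set bD : ℝ := (H.groundStateFunctional (D * K * D)).re with hbD_def
  set Qc : ℝ := xyFieldEnergy (2 * k) (fun x => Real.cos (torusPhase (2 * k) p x)) with hQc_def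
  set Qs : ℝ := xyFieldEnergy (2 * k) (fun x => Real.sin (torusPhase (2 * k) p x)) with hQs_def
  have hLd : 0 < (((2 * k : ℕ) : ℝ)) ^ d := by
    have : (0 : ℝ) < ((2 * k : ℕ) : ℝ) := by exact_mod_cast (show 0 < 2 * k by omega)
    positivity
  set ε : ℝ := heisBondCorr (d := d) 0 (2 * k) n with hε_def
  have h2E : (2 * E) ≠ 0 := by positivity
  -- the staggered fields of the two waves at momentum `p` are the modes at `q = p + Q`
  have hVc : heisStagGradField (2 * k) n (fun x => Real.cos (torusPhase (2 * k) p x)) =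
      ((2 * E : ℝ) : ℂ) • C := by
    have h := heisStagGradField_cos k n p
    rw [← hQ_def, hpQ] at h
    exact h
  have hVs : heisStagGradField (2 * k) n (fun x => Real.sin (torusPhase (2 * k) p x)) =
      ((2 * E : ℝ) : ℂ) • D := by
    have h := heisStagGradField_sin k n p
    rw [← hQ_def, hpQ] at h
    exact h
  -- the two quadratic inequalities
  have hquadC : ∀ μ : ℝ, 0 ≤ (2 * E)⁻¹ ^ 2 * Qc / 2 + 2 * μ * aC + μ ^ 2 * bC := fun μ =>
    heis_modeQuadratic_nonneg (2 * k) n hGD (xyCosMode_isHermitian (2 * k) n q) hVc h2E μ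
  have hquadS : ∀ μ : ℝ, 0 ≤ (2 * E)⁻¹ ^ 2 * Qs / 2 + 2 * μ * aD + μ ^ 2 * bD := fun μ =>
    heis_modeQuadratic_nonneg (2 * k) n hGD (xySinMode_isHermitian (2 * k) n q) hVs h2E μ
  have hQsum : (2 * E)⁻¹ ^ 2 * Qc / 2 + (2 * E)⁻¹ ^ 2 * Qs / 2 = (((2 * k : ℕ) : ℝ)) ^ d / (4 * E) := by
    have h := xyFieldEnergy_cos_add_sin (2 * k) p
    rw [← hQc_def, ← hQs_def, ← hE_def] at h
    rw [show (2 * E)⁻¹ ^ 2 * Qc / 2 + (2 * E)⁻¹ ^ 2 * Qs / 2 = (2 * E)⁻¹ ^ 2 * (Qc + Qs) / 2 by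
      ring, h]
    field_simp
    ring
  have hdisc : (aC + aD) ^ 2 ≤ (bC + bD) * ((((2 * k : ℕ) : ℝ)) ^ d / (4 * E)) := by
    have hq' : ∀ x : ℝ, 0 ≤ (bC + bD) * (x * x) + 2 * (aC + aD) * x +
        (((2 * k : ℕ) : ℝ)) ^ d / (4 * E) := by
      intro x
      have h1 := hquadC x
      have h2 := hquadS x
      rw [← hQsum]
      linarith [h1, h2]
    have hd' := discrim_le_zero hq'
    rw [discrim] at hd'
    nlinarith [hd']
  -- `aC + aD = L^d ĝ_q`
  have hA : heisStructureFactor 0 (2 * k) n q * (((2 * k : ℕ) : ℝ)) ^ d = aC + aD :=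
    heisStructureFactor_eq_modes (2 * k) n q
  -- `bC + bD = -2 ε L^d E_q`
  have hB : bC + bD = -2 * ε * (((2 * k : ℕ) : ℝ)) ^ d * Eq := by
    rw [hbC_def, hbD_def, Matrix.re_groundStateFunctional_conj_eq_lie_lie hH C,
      Matrix.re_groundStateFunctional_conj_eq_lie_lie hH D, ← add_div,
      re_groundStateFunctional_heis_lie_lie_modes (2 * k) n hL3 q, hEq_def, dispersion]
    rw [sum_congr rfl fun i _ => by rw [sum_heisGroundCorr_dir_eq_bondCorr (2 * k) n hd 0 i],
      ← sum_mul, ← hε_def]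
    ring
  -- positivity of `ĝ_q`
  have haC : 0 ≤ aC := re_groundStateFunctional_mul_self_nonneg H (xyCosMode_isHermitian (2 * k) n q)
  have haD : 0 ≤ aD := re_groundStateFunctional_mul_self_nonneg H (xySinMode_isHermitian (2 * k) n q)
  have hg0 : 0 ≤ heisStructureFactor 0 (2 * k) n q := by
    have h0 : 0 ≤ heisStructureFactor 0 (2 * k) n q * (((2 * k : ℕ) : ℝ)) ^ d := by
      rw [hA]; exact add_nonneg haC haD
    exact nonneg_of_mul_nonneg_left h0 hLd
  refine ⟨hg0, ?_⟩
  rw [hB, ← hA] at hdisc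
  -- `(L^d ĝ)² ≤ -2εL^dE_q · L^d/(4E)` ⇒ `ĝ² E ≤ (-ε/2) E_q`
  have h1 : heisStructureFactor 0 (2 * k) n q ^ 2 * E * (4 * ((((2 * k : ℕ) : ℝ)) ^ d) ^ 2) ≤
      (-2 * ε * Eq) * ((((2 * k : ℕ) : ℝ)) ^ d) ^ 2 := by
    have h4E : 0 < 4 * E := by positivity
    have := mul_le_mul_of_nonneg_right hdisc h4E.le
    calc heisStructureFactor 0 (2 * k) n q ^ 2 * E * (4 * ((((2 * k : ℕ) : ℝ)) ^ d) ^ 2)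
        = (heisStructureFactor 0 (2 * k) n q * (((2 * k : ℕ) : ℝ)) ^ d) ^ 2 * (4 * E) := by ring
      _ ≤ -2 * ε * (((2 * k : ℕ) : ℝ)) ^ d * Eq * ((((2 * k : ℕ) : ℝ)) ^ d / (4 * E)) * (4 * E) :=
          this
      _ = (-2 * ε * Eq) * ((((2 * k : ℕ) : ℝ)) ^ d) ^ 2 := by field_simp
  have hL2 : (0 : ℝ) < ((((2 * k : ℕ) : ℝ)) ^ d) ^ 2 := by positivity
  have h2 : heisStructureFactor 0 (2 * k) n q ^ 2 * E * 4 ≤ -2 * ε * Eq := by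
    refine le_of_mul_le_mul_right ?_ hL2
    calc heisStructureFactor 0 (2 * k) n q ^ 2 * E * 4 * ((((2 * k : ℕ) : ℝ)) ^ d) ^ 2
        = heisStructureFactor 0 (2 * k) n q ^ 2 * E * (4 * ((((2 * k : ℕ) : ℝ)) ^ d) ^ 2) := by
          ring
      _ ≤ (-2 * ε * Eq) * ((((2 * k : ℕ) : ℝ)) ^ d) ^ 2 := h1
  show heisStructureFactor 0 (2 * k) n q ^ 2 * E ≤ (-ε / 2) * Eq
  linarith [h2]

end InfraredAssembly

end Literature.MathematicalPhysics.QuantumLattice
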